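import Literature.Geometry.Kaehler.MilnorSymbolCocycle
import HarnessLib

/-!
# Alternation in the naive Milnor relations: `2·{x, −x} ≡ 0` on small opens

Theorems file of route `MilnorKExponential` of the Hodge summit, crux `SymbolLiftR`
(stmt-HodgeConjecture-18702), kernel `stub_primitiveLiftExists`, abelian sector (the weight-2
Appell–Humbert line, `Cruxes/SymbolLiftR/AH2-REPORT.md`). The weight-2 Appell–Humbert calculus models
Milnor symbols of exponential-affine units by the ALTERNATING square `∧²` of the unit group `⊗ ℚ`; its
soundness ("a formal cocycle is an honest Čech cocycle modulo the naive Milnor relations") rests on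
three facts about the naive relations of `Literature.Geometry.Kaehler.milnorRel` on a small open `W`:
bilinearity (a defining relation), the death of torsion units (`TorsionSymbolsDie`), and ALTERNATION —
`{x, x}` is torsion. Over a field `{x, −x} = 1` is Milnor's identity (Milnor (1971), Lemma 11.? in §11;
for local rings with infinite residue field Nesterenko–Suslin / Kerz); in the NAIVE relations over an
open `W` on which `x` may take the value `1` the textbook derivation `−x = (1−x)/(1−x⁻¹)` is not
available, and this file proves the replacement used by the calculus:

* `mk_symbol_neg_self_eq_zero` — `{u, −u} ≡ 0` for a unit `u` omitting the value `1` on `W`;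
* `two_smul_single_neg_self_mem_milnorRel` — **`2·[x, −x] ∈ milnorRel E W 2`** for EVERY unit `x`
  on `W`, given one constant `c ∉ {0, 1}` with `x ≠ c` and `x·c ≠ 1` on `W` (available after
  shrinking `W` around any point): the identities `{x,−x} ≡ {x,c} + {c,x}` (from `{x, c − x}` expanded
  two ways) and `{xc, −xc} ≡ 0 ≡ {x,−x} + {x,c} + {c,x}` add up to `2{x,−x} ≡ 0`.

All statements are memberships in / identities modulo `milnorRel E W 2`, derived only from its three
generating families (pointwise agreement, multilinearity, Steinberg).

References: J. Milnor, *Introduction to Algebraic K-Theory*, Ann. of Math. Studies 72 (1971), §11;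
M. Kerz, *The Gersten conjecture for Milnor K-theory*, Invent. Math. 175 (2009), §2.
-/

noncomputable section

-- The mandated namespace repeats `HodgeConjecture` (single-conjunct summit).
set_option linter.dupNamespace false

open scoped Manifold
open Function

namespace Summit.HodgeConjecture.HodgeConjecture.Theorems.SymbolLiftR

open Literature.Geometry.Kaehler

/-- Updating the first entry of a pair. [folklore] -/
theorem update_pair_zero {α : Type*} (a b c : α) : update ![a, b] 0 c = ![c, b] := by
  funext i
  fin_cases i <;> simp

/-- Updating the second entry of a pair. [folklore] -/
theorem update_pair_one {α : Type*} (a b c : α) : update ![a, b] 1 c = ![a, c] := by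
  funext i
  fin_cases i <;> simp

variable {E : Type*} [NormedAddCommGroup E] [NormedSpace ℂ E]
  {M : Type*} [TopologicalSpace M] [ChartedSpace E M] {W : Set M}

/-! ### Units: negation, `1 - u`, pairs -/

/-- The negative of a unit on `W` is a unit on `W`. [folklore] -/
theorem isHolUnitOn_neg {u : M → ℂ} (hu : IsHolUnitOn E W u) : IsHolUnitOn E W (-u) :=
  ⟨hu.1.neg, fun x hx ↦ neg_ne_zero.2 (hu.2 x hx)⟩

/-- `1 - u` is a unit on `W` when the unit `u` omits the value `1` on `W`. [folklore] -/
theorem isHolUnitOn_one_sub {u : M → ℂ} (hu : IsHolUnitOn E W u) (h1 : ∀ x ∈ W, u x ≠ 1) :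
    IsHolUnitOn E W (1 - u) :=
  ⟨mdifferentiableOn_const.sub hu.1, fun x hx ↦ sub_ne_zero.2 (h1 x hx).symm⟩

/-- A pair of units is a good `2`-tuple. [folklore] -/
theorem isGoodTuple_pair {a b : M → ℂ} (ha : IsHolUnitOn E W a) (hb : IsHolUnitOn E W b) :
    IsGoodTuple E W ![a, b] := by
  intro i
  fin_cases i
  · exact ha
  · exact hb

/-! ### The symbol `{a, b}` modulo the naive relations, and its defining rules -/

section Symbol

variable (E W)

/-- The class of the symbol chain `[a, b]` in the naive Milnor `K₂`-presheaf quotient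
`ℤ[pairs] ⧸ milnorRel E W 2`, as a value of the quotient map (an additive homomorphism).
[cite: Milnor1972, §11 Thm. 11.1] -/
theorem mk_single_eq (a b : M → ℂ) :
    QuotientAddGroup.mk' (milnorRel E W 2) (Finsupp.single ![a, b] (1 : ℤ)) =
      (QuotientAddGroup.mk (Finsupp.single ![a, b] (1 : ℤ)) : _ ⧸ milnorRel E W 2) :=
  rfl

variable {E W}

/-! All rules below are stated for an arbitrary additive map `φ` killing `milnorRel E W 2` (the
quotient map `QuotientAddGroup.mk' (milnorRel E W 2)` is the universal one); `φ [a, b]` is the symbol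
`{a, b}` read through `φ`. -/

variable {A : Type*} [AddCommGroup A] (φ : ((Fin 2 → M → ℂ) →₀ ℤ) →+ A)
  (hφ : ∀ s ∈ milnorRel E W 2, φ s = 0)

include hφ

/-- Relation (a) in the quotient: symbols of pairs that agree on `W` coincide. [folklore] -/
theorem mk_symbol_congr {a b a' b' : M → ℂ} (ha : IsHolUnitOn E W a) (hb : IsHolUnitOn E W b)
    (ha' : IsHolUnitOn E W a') (hb' : IsHolUnitOn E W b') (hea : ∀ x ∈ W, a x = a' x)
    (heb : ∀ x ∈ W, b x = b' x) : φ (Finsupp.single ![a, b] 1) = φ (Finsupp.single ![a', b'] 1) := by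
  have h := single_sub_single_mem_milnorRel (E := E) (p := 2) (isGoodTuple_pair ha hb)
    (isGoodTuple_pair ha' hb') (fun i x hx ↦ by fin_cases i <;> simp [hea x hx, heb x hx])
  have h0 : φ
      (Finsupp.single ![a, b] (1 : ℤ) - Finsupp.single ![a', b'] 1) = 0 :=
    hφ _ h
  rwa [map_sub, sub_eq_zero] at h0

/-- Relation (b), first slot: `{a·g, y} = {a, y} + {g, y}`. [cite: Milnor1972, §11 Thm. 11.1] -/
theorem mk_symbol_mul_left {a g y : M → ℂ} (ha : IsHolUnitOn E W a) (hg : IsHolUnitOn E W g)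
    (hy : IsHolUnitOn E W y) : φ (Finsupp.single ![a * g, y] 1) = φ (Finsupp.single ![a, y] 1) + φ (Finsupp.single ![g, y] 1) := by
  have h := multilinear_mem_milnorRel (E := E) (p := 2) (isGoodTuple_pair ha hy) 0 hg
  rw [show (![a, y] : Fin 2 → M → ℂ) 0 = a from rfl, update_pair_zero, update_pair_zero] at h
  have h0 : φ
      (Finsupp.single ![a * g, y] (1 : ℤ) - Finsupp.single ![a, y] 1 - Finsupp.single ![g, y] 1) = 0 :=
    hφ _ h
  rw [map_sub, map_sub] at h0
  linear_combination (norm := abel) h0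

/-- Relation (b), second slot: `{y, a·g} = {y, a} + {y, g}`. [cite: Milnor1972, §11 Thm. 11.1] -/
theorem mk_symbol_mul_right {a g y : M → ℂ} (hy : IsHolUnitOn E W y) (ha : IsHolUnitOn E W a)
    (hg : IsHolUnitOn E W g) : φ (Finsupp.single ![y, a * g] 1) = φ (Finsupp.single ![y, a] 1) + φ (Finsupp.single ![y, g] 1) := by
  have h := multilinear_mem_milnorRel (E := E) (p := 2) (isGoodTuple_pair hy ha) 1 hg
  rw [show (![y, a] : Fin 2 → M → ℂ) 1 = a from rfl, update_pair_one, update_pair_one] at h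
  have h0 : φ
      (Finsupp.single ![y, a * g] (1 : ℤ) - Finsupp.single ![y, a] 1 - Finsupp.single ![y, g] 1) = 0 :=
    hφ _ h
  rw [map_sub, map_sub] at h0
  linear_combination (norm := abel) h0

/-- Relation (c), Steinberg: `{u, v} = 0` when `u + v = 1` on `W`. [cite: Milnor1972, §11 Thm. 11.1] -/
theorem mk_symbol_steinberg {u v : M → ℂ} (hu : IsHolUnitOn E W u) (hv : IsHolUnitOn E W v)
    (h : ∀ x ∈ W, u x + v x = 1) : φ (Finsupp.single ![u, v] 1) = 0 :=
  hφ _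
    (steinberg_mem_milnorRel (E := E) (p := 2) (isGoodTuple_pair hu hv) (i := 0) (j := 1)
      (by decide) h)

/-- `{1, y} = 0`. [folklore] -/
theorem mk_symbol_one_left {y : M → ℂ} (hy : IsHolUnitOn E W y) : φ (Finsupp.single ![(1 : M → ℂ), y] 1) = 0 := by
  have h := mk_symbol_mul_left φ hφ (isHolUnitOn_one W) (isHolUnitOn_one W) hy
  rw [one_mul] at h
  linear_combination (norm := abel) -h

/-- `{y, 1} = 0`. [folklore] -/
theorem mk_symbol_one_right {y : M → ℂ} (hy : IsHolUnitOn E W y) : φ (Finsupp.single ![y, (1 : M → ℂ)] 1) = 0 := by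
  have h := mk_symbol_mul_right φ hφ hy (isHolUnitOn_one W) (isHolUnitOn_one W)
  rw [one_mul] at h
  linear_combination (norm := abel) -h

/-- `{a⁻¹, y} = −{a, y}`. [folklore] -/
theorem mk_symbol_inv_left {a y : M → ℂ} (ha : IsHolUnitOn E W a) (hy : IsHolUnitOn E W y) :
    φ (Finsupp.single ![a⁻¹, y] 1) = -φ (Finsupp.single ![a, y] 1) := by
  have h := mk_symbol_mul_left φ hφ ha ha.inv hy
  have h1 : φ (Finsupp.single ![a * a⁻¹, y] 1) = φ (Finsupp.single ![(1 : M → ℂ), y] 1) :=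
    mk_symbol_congr φ hφ (ha.mul ha.inv) hy (isHolUnitOn_one W) hy
      (fun x hx ↦ by simp [mul_inv_cancel₀ (ha.2 x hx)]) (fun _ _ ↦ rfl)
  rw [h1, mk_symbol_one_left φ hφ hy] at h
  linear_combination (norm := abel) -h

/-- `{y, a⁻¹} = −{y, a}`. [folklore] -/
theorem mk_symbol_inv_right {a y : M → ℂ} (hy : IsHolUnitOn E W y) (ha : IsHolUnitOn E W a) :
    φ (Finsupp.single ![y, a⁻¹] 1) = -φ (Finsupp.single ![y, a] 1) := by
  have h := mk_symbol_mul_right φ hφ hy ha ha.inv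
  have h1 : φ (Finsupp.single ![y, a * a⁻¹] 1) = φ (Finsupp.single ![y, (1 : M → ℂ)] 1) :=
    mk_symbol_congr φ hφ hy (ha.mul ha.inv) hy (isHolUnitOn_one W) (fun _ _ ↦ rfl)
      (fun x hx ↦ by simp [mul_inv_cancel₀ (ha.2 x hx)])
  rw [h1, mk_symbol_one_right φ hφ hy] at h
  linear_combination (norm := abel) -h

/-! ### Alternation -/

/-- **`{u, −u} ≡ 0` for a unit `u` omitting the value `1` on `W`**: the textbook identity
`−u = (1 − u)(1 − u⁻¹)⁻¹` with the two Steinberg symbols `{u, 1 − u}`, `{u⁻¹, 1 − u⁻¹}`.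
[cite: Milnor1972, §11 Thm. 11.1] -/
theorem mk_symbol_neg_self_eq_zero {u : M → ℂ} (hu : IsHolUnitOn E W u) (h1 : ∀ x ∈ W, u x ≠ 1) :
    φ (Finsupp.single ![u, -u] 1) = 0 := by
  have h1' : ∀ x ∈ W, u⁻¹ x ≠ 1 := fun x hx ↦ by
    rw [Pi.inv_apply]
    exact fun h ↦ h1 x hx (inv_eq_one.1 h)
  have hA : IsHolUnitOn E W (1 - u) := isHolUnitOn_one_sub hu h1
  have hB : IsHolUnitOn E W (1 - u⁻¹) := isHolUnitOn_one_sub hu.inv h1'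
  -- `−u = (1 − u) · (1 − u⁻¹)⁻¹` on `W`
  have hneg : φ (Finsupp.single ![u, -u] 1) = φ (Finsupp.single ![u, (1 - u) * (1 - u⁻¹)⁻¹] 1) := by
    refine mk_symbol_congr φ hφ hu (isHolUnitOn_neg hu) hu (hA.mul hB.inv) (fun _ _ ↦ rfl) fun x hx ↦ ?_
    have hx0 : u x ≠ 0 := hu.2 x hx
    have hx2 : -1 + u x ≠ 0 := by
      rw [neg_add_eq_sub]
      exact sub_ne_zero.2 (h1 x hx)
    have hx3 : u x - 1 ≠ 0 := sub_ne_zero.2 (h1 x hx)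
    simp only [Pi.neg_apply, Pi.mul_apply, Pi.sub_apply, Pi.one_apply, Pi.inv_apply]
    field_simp
    ring
  rw [hneg, mk_symbol_mul_right φ hφ hu hA hB.inv, mk_symbol_inv_right φ hφ hu hB,
    mk_symbol_steinberg φ hφ hu hA (fun x _ ↦ by simp)]
  -- `{u, 1 − u⁻¹} = −{u⁻¹, 1 − u⁻¹} = 0`
  have hC : φ (Finsupp.single ![u, 1 - u⁻¹] 1) = -φ (Finsupp.single ![u⁻¹, 1 - u⁻¹] 1) := by
    have := mk_symbol_inv_left φ hφ hu.inv hB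
    rw [inv_inv] at this
    exact this
  rw [hC, mk_symbol_steinberg φ hφ hu.inv hB (fun x _ ↦ by simp)]
  simp

/-- **`2·{x, −x} ≡ 0` for EVERY unit `x` on `W`**, given a constant `c ≠ 0, 1` with `x ≠ c` and
`x·c ≠ 1` on `W`. Identities modulo `milnorRel E W 2`: (E1) `{x, −x} = {x, c} + {c, x}`, obtained by
expanding `{x, c − x}` as `{x, c(1 − x c⁻¹)}` and as `{x, (−x)(1 − c x⁻¹)}` (Steinberg for `x c⁻¹`,
`c x⁻¹`; `(1 − x c⁻¹)(1 − c x⁻¹)⁻¹ = −x c⁻¹`; `{c, −c⁻¹} = 0`); (E2) `0 = {xc, −xc} = {x, −x} + {x, c} + {c, x}`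
(`mk_symbol_neg_self_eq_zero` for `xc` and for `c`). Their sum is `2{x, −x} = 0`.
[cite: Milnor1972, §11 Thm. 11.1] [cite: Kerz2009GerstenMilnorK, §2] -/
theorem two_smul_mk_symbol_neg_self {x : M → ℂ} (hx : IsHolUnitOn E W x) {c : ℂ} (hc0 : c ≠ 0)
    (hc1 : c ≠ 1) (hxc : ∀ z ∈ W, x z ≠ c) (hxc' : ∀ z ∈ W, x z * c ≠ 1) :
    (2 : ℤ) • φ (Finsupp.single ![x, -x] 1) = 0 := by
  -- the cast of constants and the units in play
  set k : M → ℂ := fun _ ↦ c with hk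
  have hk0 : IsHolUnitOn E W k := isHolUnitOn_const hc0 W
  have hkinv1 : ∀ z ∈ W, k⁻¹ z ≠ 1 := fun z _ ↦ by
    simp only [hk, Pi.inv_apply]
    exact fun h ↦ hc1 (inv_eq_one.1 h)
  have hk1 : ∀ z ∈ W, k z ≠ 1 := fun z _ ↦ hc1
  have hxk : IsHolUnitOn E W (x * k⁻¹) := hx.mul hk0.inv
  have hkx : IsHolUnitOn E W (k * x⁻¹) := hk0.mul hx.inv
  have hxk1 : ∀ z ∈ W, (x * k⁻¹) z ≠ 1 := fun z hz h ↦ hxc z hz (by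
    have : x z * c⁻¹ = 1 := by simpa [hk] using h
    field_simp at this
    simpa using this)
  have hkx1 : ∀ z ∈ W, (k * x⁻¹) z ≠ 1 := fun z hz h ↦ hxc z hz (by
    have hz0 : x z ≠ 0 := hx.2 z hz
    have : c * (x z)⁻¹ = 1 := by simpa [hk] using h
    field_simp at this
    simpa [eq_comm] using this)
  have hA : IsHolUnitOn E W (1 - x * k⁻¹) := isHolUnitOn_one_sub hxk hxk1
  have hB : IsHolUnitOn E W (1 - k * x⁻¹) := isHolUnitOn_one_sub hkx hkx1
  have hcx : IsHolUnitOn E W (k - x) :=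
    ⟨mdifferentiableOn_const.sub hx.1, fun z hz ↦ sub_ne_zero.2 (hxc z hz).symm⟩
  -- (E1a) `{x, c − x} = {x, c} + {c, 1 − x c⁻¹}`
  have e1a : φ (Finsupp.single ![x, k - x] 1) = φ (Finsupp.single ![x, k] 1) + φ (Finsupp.single ![k, 1 - x * k⁻¹] 1) := by
    have s1 : φ (Finsupp.single ![x, k - x] 1) = φ (Finsupp.single ![x, k * (1 - x * k⁻¹)] 1) :=
      mk_symbol_congr φ hφ hx hcx hx (hk0.mul hA) (fun _ _ ↦ rfl) fun z _ ↦ by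
        simp only [hk, Pi.sub_apply, Pi.mul_apply, Pi.one_apply, Pi.inv_apply]
        field_simp
    have s2 : φ (Finsupp.single ![x, 1 - x * k⁻¹] 1) = φ (Finsupp.single ![x * k⁻¹ * k, 1 - x * k⁻¹] 1) :=
      mk_symbol_congr φ hφ hx hA (hxk.mul hk0) hA (fun z _ ↦ by
        simp only [hk, Pi.mul_apply, Pi.inv_apply]
        field_simp) (fun _ _ ↦ rfl)
    rw [s1, mk_symbol_mul_right φ hφ hx hk0 hA, s2, mk_symbol_mul_left φ hφ hxk hk0 hA,
      mk_symbol_steinberg φ hφ hxk hA (fun z _ ↦ by simp)]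
    abel
  -- (E1b) `{x, c − x} = {x, −x} + {c, 1 − c x⁻¹}`
  have e1b : φ (Finsupp.single ![x, k - x] 1) = φ (Finsupp.single ![x, -x] 1) + φ (Finsupp.single ![k, 1 - k * x⁻¹] 1) := by
    have s1 : φ (Finsupp.single ![x, k - x] 1) = φ (Finsupp.single ![x, (-x) * (1 - k * x⁻¹)] 1) :=
      mk_symbol_congr φ hφ hx hcx hx ((isHolUnitOn_neg hx).mul hB) (fun _ _ ↦ rfl) fun z hz ↦ by
        have hz0 : x z ≠ 0 := hx.2 z hz
        simp only [hk, Pi.sub_apply, Pi.mul_apply, Pi.one_apply, Pi.inv_apply, Pi.neg_apply]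
        field_simp
        ring
    have s2 : φ (Finsupp.single ![x, 1 - k * x⁻¹] 1) = -φ (Finsupp.single ![x⁻¹, 1 - k * x⁻¹] 1) := by
      have := mk_symbol_inv_left φ hφ hx.inv hB
      rw [inv_inv] at this
      exact this
    have s3 : φ (Finsupp.single ![x⁻¹, 1 - k * x⁻¹] 1) = φ (Finsupp.single ![k * x⁻¹ * k⁻¹, 1 - k * x⁻¹] 1) :=
      mk_symbol_congr φ hφ hx.inv hB (hkx.mul hk0.inv) hB (fun z _ ↦ by
        simp only [hk, Pi.mul_apply, Pi.inv_apply]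
        field_simp) (fun _ _ ↦ rfl)
    rw [s1, mk_symbol_mul_right φ hφ hx (isHolUnitOn_neg hx) hB, s2, s3, mk_symbol_mul_left φ hφ hkx hk0.inv hB,
      mk_symbol_steinberg φ hφ hkx hB (fun z _ ↦ by simp), mk_symbol_inv_left φ hφ hk0 hB]
    abel
  -- (E1c) `{c, 1 − x c⁻¹} − {c, 1 − c x⁻¹} = {c, x}`
  have e1c : φ (Finsupp.single ![k, 1 - x * k⁻¹] 1) - φ (Finsupp.single ![k, 1 - k * x⁻¹] 1) = φ (Finsupp.single ![k, x] 1) := by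
    have s1 : φ (Finsupp.single ![k, 1 - x * k⁻¹] 1) - φ (Finsupp.single ![k, 1 - k * x⁻¹] 1) = φ (Finsupp.single ![k, (1 - x * k⁻¹) * (1 - k * x⁻¹)⁻¹] 1) := by
      rw [mk_symbol_mul_right φ hφ hk0 hA hB.inv, mk_symbol_inv_right φ hφ hk0 hB]
      abel
    have s2 : φ (Finsupp.single ![k, (1 - x * k⁻¹) * (1 - k * x⁻¹)⁻¹] 1) = φ (Finsupp.single ![k, (-k⁻¹) * x] 1) :=
      mk_symbol_congr φ hφ hk0 (hA.mul hB.inv) hk0 ((isHolUnitOn_neg hk0.inv).mul hx) (fun _ _ ↦ rfl)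
        fun z hz ↦ by
          have hz0 : x z ≠ 0 := hx.2 z hz
          have hzc : x z - c ≠ 0 := sub_ne_zero.2 (hxc z hz)
          have hB0 : 1 - c * (x z)⁻¹ ≠ 0 := by
            have := hB.2 z hz
            simpa [hk] using this
          simp only [hk, Pi.sub_apply, Pi.mul_apply, Pi.one_apply, Pi.inv_apply, Pi.neg_apply]
          field_simp
          ring
    rw [s1, s2, mk_symbol_mul_right φ hφ hk0 (isHolUnitOn_neg hk0.inv) hx]
    have s3 : φ (Finsupp.single ![k, -k⁻¹] 1) = 0 := by
      rw [show φ (Finsupp.single ![k, -k⁻¹] 1) = -φ (Finsupp.single ![k⁻¹, -k⁻¹] 1) from by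
        have := mk_symbol_inv_left φ hφ hk0.inv (isHolUnitOn_neg hk0.inv)
        rw [inv_inv] at this
        exact this]
      rw [mk_symbol_neg_self_eq_zero φ hφ hk0.inv hkinv1, neg_zero]
    rw [s3, zero_add]
  -- (E1) `{x, −x} = {x, c} + {c, x}`
  have e1 : φ (Finsupp.single ![x, -x] 1) = φ (Finsupp.single ![x, k] 1) + φ (Finsupp.single ![k, x] 1) := by
    have := e1a.symm.trans e1b
    linear_combination (norm := abel) -this + e1c
  -- (E2) `0 = {xc, −xc} = {x, −x} + {x, c} + {c, x}`
  have e2 : φ (Finsupp.single ![x, -x] 1) + φ (Finsupp.single ![x, k] 1) + φ (Finsupp.single ![k, x] 1) = 0 := by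
    have hxkU : IsHolUnitOn E W (x * k) := hx.mul hk0
    have h0 : φ (Finsupp.single ![x * k, -(x * k)] 1) = 0 :=
      mk_symbol_neg_self_eq_zero φ hφ hxkU fun z hz ↦ by simpa [hk] using hxc' z hz
    have s1 : φ (Finsupp.single ![x * k, -(x * k)] 1) = φ (Finsupp.single ![x, -(x * k)] 1) + φ (Finsupp.single ![k, -(x * k)] 1) :=
      mk_symbol_mul_left φ hφ hx hk0 (isHolUnitOn_neg hxkU)
    have s2 : φ (Finsupp.single ![x, -(x * k)] 1) = φ (Finsupp.single ![x, -x] 1) + φ (Finsupp.single ![x, k] 1) := by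
      rw [show φ (Finsupp.single ![x, -(x * k)] 1) = φ (Finsupp.single ![x, (-x) * k] 1) from
        mk_symbol_congr φ hφ hx (isHolUnitOn_neg hxkU) hx ((isHolUnitOn_neg hx).mul hk0) (fun _ _ ↦ rfl)
          (fun z _ ↦ by simp), mk_symbol_mul_right φ hφ hx (isHolUnitOn_neg hx) hk0]
    have s3 : φ (Finsupp.single ![k, -(x * k)] 1) = φ (Finsupp.single ![k, -k] 1) + φ (Finsupp.single ![k, x] 1) := by
      rw [show φ (Finsupp.single ![k, -(x * k)] 1) = φ (Finsupp.single ![k, (-k) * x] 1) from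
        mk_symbol_congr φ hφ hk0 (isHolUnitOn_neg hxkU) hk0 ((isHolUnitOn_neg hk0).mul hx) (fun _ _ ↦ rfl)
          (fun z _ ↦ by simp [mul_comm]), mk_symbol_mul_right φ hφ hk0 (isHolUnitOn_neg hk0) hx]
    rw [s1, s2, s3, mk_symbol_neg_self_eq_zero φ hφ hk0 hk1, zero_add] at h0
    linear_combination (norm := abel) h0
  -- add up
  have : (2 : ℤ) • φ (Finsupp.single ![x, -x] 1) = φ (Finsupp.single ![x, -x] 1) + φ (Finsupp.single ![x, -x] 1) := two_zsmul _
  rw [this]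
  linear_combination (norm := abel) e1 + e2

end Symbol

/-- STUB-HELPER `stub_two_smul_single_neg_self_mem_milnorRel` (first lemma of the weight-2
Appell–Humbert line for the kernel `stub_primitiveLiftExists` of crux stmt-HodgeConjecture-18702, abelian
sector): **alternation in the naive Milnor relations** — for a unit `x` on `W` and a constant
`c ∉ {0, 1}` with `x ≠ c`, `x·c ≠ 1` on `W`, the chain `2·[x, −x]` lies in `milnorRel E W 2`.
[cite: Milnor1972, §11 Thm. 11.1] [cite: Kerz2009GerstenMilnorK, §2] -/
theorem stub_two_smul_single_neg_self_mem_milnorRel : ∀ {E : Type*} [NormedAddCommGroup E] [NormedSpace ℂ E] {M : Type*} [TopologicalSpace M] [ChartedSpace E M] {W : Set M} {x : M → ℂ}, IsHolUnitOn E W x → ∀ {c : ℂ}, c ≠ 0 → c ≠ 1 → (∀ z ∈ W, x z ≠ c) → (∀ z ∈ W, x z * c ≠ 1) → (2 : ℤ) • Finsupp.single ![x, -x] (1 : ℤ) ∈ milnorRel E W 2 := by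
  intro E _ _ M _ _ W x hx c hc0 hc1 hxc hxc'
  have h := two_smul_mk_symbol_neg_self (QuotientAddGroup.mk' (milnorRel E W 2))
    (fun s hs ↦ (QuotientAddGroup.eq_zero_iff s).2 hs) hx hc0 hc1 hxc hxc'
  rw [← map_zsmul] at h
  exact (QuotientAddGroup.eq_zero_iff _).1 h

end Summit.HodgeConjecture.HodgeConjecture.Theorems.SymbolLiftR

end
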